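import Literature.NumberTheory.NumberFields.SelmerGroupOddClass
import Literature.NumberTheory.NumberFields.ClassGroupCert
import HarnessLib

/-!
# BirchSwinnertonDyer — rank ≥ 2 observatory: `K(S,2)` inside the `T`-units for an ARBITRARY class group

HONEST FRAMING: per-curve certified theorems and census instruments; no claim on BSD in rank ≥ 2.

First generic file of the KERNEL-2DESC-CL instrument (cell `b2b-bsdr2`, seat cert-1, design
`b2b-bsdr2-cert-1/KERNEL-2DESC-CL.md`): the class-group-general replacement for the PID step
`Literature…SelmerGroupPID.exists_isSquare_mul_of_two_dvd_log_valuation` (and its odd-class-number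
variant `…SelmerGroupOddClass`) used by cert-3's KERNEL-2DESC `V`-cover. Silverman's proof of
AEC Prop. VIII.1.6 enlarges the set `S` of bad places to a finite set `T ⊇ S` whose prime ideals
GENERATE the class group, so that the ring of `T`-integers is principal; then every `b ∈ Kˣ` with
`ord_v(b)` even for all `v ∉ S` is a `T`-unit times a square. Here `T` = the primes containing a
fixed `N ∈ 𝓞 K` (in the applications `N` is a natural number: all primes above the rational primes
below `S` and one auxiliary rational prime), and everything is phrased inside `𝓞 K`:

* `exists_tsupp_of_mem_closure`: the subgroup of `Cl(𝓞 K)` generated by the classes of the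
  ideals containing `N` consists of the classes of the ideals `J` *supported on `T`*
  (`∃ c, N ^ c ∈ J`: every prime factor of `J` contains `N`);
* `exists_span_eq_mul_of_closure_eq_top`: if that subgroup is everything (the `T`-primes generate
  the class group) then every prime `P` has a "`T`-complement": `(γ) = P · J` with `J` supported
  on `T`;
* `exists_tsupp_eq_mul_sq_int` / `exists_tsupp_eq_mul_sq` (**the descent**): under that
  complement hypothesis, every `b ∈ Kˣ` with `ord_v(b)` even at every prime `v ∌ N` satisfies
  `b · z² = t` for some `z ∈ Kˣ` and some `t ∈ 𝓞 K ∖ {0}` all of whose prime divisors contain `N`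
  (induction on the number of primes `P ∌ N` dividing the numerator: `ord_P` is even, `= 2e`, and
  `b · (N^c)^{2e} / γ^{2e}` has one bad prime fewer).

Sorry-free; axioms `propext`, `Classical.choice`, `Quot.sound`.
[cite: SilvermanAEC2009, Prop. VIII.1.6 (proof)] [cite: Simon2002, §2]

## References

* J. H. Silverman, *The Arithmetic of Elliptic Curves*, 2nd ed., GTM 106 (2009), Prop. VIII.1.6
  (proof: enlarge `S` so that `R_S` is a PID). [SilvermanAEC2009]
* D. Simon, *Computing the rank of elliptic curves over number fields*, LMS J. Comput. Math. 5
  (2002) 7–17, §2 (the `S`-unit / class-group algorithm for `K(S,2)`). [Simon2002]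
-/

-- single-conjunct summit: `Summit.BirchSwinnertonDyer.BirchSwinnertonDyer.…` repeats the name by design
set_option linter.dupNamespace false

noncomputable section

open scoped NumberField nonZeroDivisors
open NumberField IsDedekindDomain IsDedekindDomain.HeightOneSpectrum Ideal
open Literature.NumberTheory.NumberFields

namespace Summit.BirchSwinnertonDyer.BirchSwinnertonDyer.Rank2Observatory.TwoDescCl

variable {K : Type*} [Field K] [NumberField K]

/-! ## `T`-supported ideals and their classes

An ideal `J ≠ ⊥` is *supported on `T`* (`T` = the primes containing `N`) iff some power of `N`
lies in `J`; we use the latter, elementary form `∃ c, N ^ c ∈ J` throughout. -/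

omit [NumberField K] in
/-- `T`-supported ideals are closed under products. [folklore] -/
theorem exists_pow_mem_mul {N : 𝓞 K} {I J : Ideal (𝓞 K)} (hI : ∃ a : ℕ, N ^ a ∈ I)
    (hJ : ∃ b : ℕ, N ^ b ∈ J) : ∃ c : ℕ, N ^ c ∈ I * J := by
  obtain ⟨a, ha⟩ := hI
  obtain ⟨b, hb⟩ := hJ
  exact ⟨a + b, by rw [pow_add]; exact Ideal.mul_mem_mul ha hb⟩

omit [NumberField K] in
/-- `T`-supported ideals are closed under powers. [folklore] -/
theorem exists_pow_mem_pow {N : 𝓞 K} {J : Ideal (𝓞 K)} (hJ : ∃ a : ℕ, N ^ a ∈ J) (k : ℕ) :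
    ∃ c : ℕ, N ^ c ∈ J ^ k := by
  induction k with
  | zero => exact ⟨0, by rw [pow_zero, pow_zero, Ideal.one_eq_top]; trivial⟩
  | succ k ih => rw [pow_succ]; exact exists_pow_mem_mul ih hJ

omit [NumberField K] in
/-- A prime ideal containing a `T`-supported ideal contains `N`. [folklore] -/
theorem mem_of_exists_pow_mem_of_le {N : 𝓞 K} {J : Ideal (𝓞 K)} (hJ : ∃ c : ℕ, N ^ c ∈ J)
    (v : HeightOneSpectrum (𝓞 K)) (h : J ≤ v.asIdeal) : N ∈ v.asIdeal := by
  obtain ⟨c, hc⟩ := hJ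
  exact v.isPrime.mem_of_pow_mem c (h hc)

/-- **The subgroup of `Cl(𝓞 K)` generated by the classes of the ideals containing `N`** consists
of the classes of the `T`-supported ideals (`∃ k, N ^ k ∈ J`): these form a subgroup (closed under
products; under inverses because `[J]⁻¹ = [J]^{ord [J] - 1}`) containing the generators.
[folklore] -/
theorem exists_tsupp_of_mem_closure {N : 𝓞 K} {c : ClassGroup (𝓞 K)}
    (hc : c ∈ Subgroup.closure {c : ClassGroup (𝓞 K) | ∃ (J : Ideal (𝓞 K))
      (hJ : J ∈ (Ideal (𝓞 K))⁰), N ∈ J ∧ ClassGroup.mk0 ⟨J, hJ⟩ = c}) :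
    ∃ (J : Ideal (𝓞 K)) (hJ : J ∈ (Ideal (𝓞 K))⁰),
      (∃ k : ℕ, N ^ k ∈ J) ∧ ClassGroup.mk0 ⟨J, hJ⟩ = c := by
  induction hc using Subgroup.closure_induction with
  | mem x hx =>
    obtain ⟨J, hJ, hNJ, rfl⟩ := hx
    exact ⟨J, hJ, ⟨1, by rwa [pow_one]⟩, rfl⟩
  | one =>
    exact ⟨1, (1 : (Ideal (𝓞 K))⁰).2, ⟨0, by rw [pow_zero, Ideal.one_eq_top]; trivial⟩,
      by exact map_one ClassGroup.mk0⟩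
  | mul x y _ _ hx hy =>
    obtain ⟨I, hI, hIs, rfl⟩ := hx
    obtain ⟨J, hJ, hJs, rfl⟩ := hy
    exact ⟨I * J, mul_mem hI hJ, exists_pow_mem_mul hIs hJs, by rw [← map_mul]; rfl⟩
  | inv x _ hx =>
    obtain ⟨J, hJ, hJs, rfl⟩ := hx
    have hn : 0 < orderOf (ClassGroup.mk0 ⟨J, hJ⟩) := orderOf_pos _
    refine ⟨J ^ (orderOf (ClassGroup.mk0 ⟨J, hJ⟩) - 1), pow_mem hJ _, exists_pow_mem_pow hJs _, ?_⟩
    have hpow : ClassGroup.mk0 ⟨J ^ (orderOf (ClassGroup.mk0 ⟨J, hJ⟩) - 1), pow_mem hJ _⟩ =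
        ClassGroup.mk0 ⟨J, hJ⟩ ^ (orderOf (ClassGroup.mk0 ⟨J, hJ⟩) - 1) := by
      rw [← map_pow]
      congr 1
    rw [hpow, eq_inv_iff_mul_eq_one, ← pow_succ, Nat.sub_add_cancel hn, pow_orderOf_eq_one]

/-- Every ideal containing `N` (e.g. a prime above a rational prime dividing `N`) has its class in
that subgroup — in the `ClassIn` language of `Literature…ClassGroupCert`, whose
`classGroup_eq_top_of_classIn` is how the per-field certificates prove generation. [folklore] -/
theorem classIn_closure_of_mem {N : 𝓞 K} {J : Ideal (𝓞 K)} (hJ : N ∈ J) :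
    ClassIn (Subgroup.closure {c : ClassGroup (𝓞 K) | ∃ (J : Ideal (𝓞 K))
      (hJ : J ∈ (Ideal (𝓞 K))⁰), N ∈ J ∧ ClassGroup.mk0 ⟨J, hJ⟩ = c}) J :=
  fun hJ0 => Subgroup.subset_closure ⟨J, hJ0, hJ, rfl⟩

/-- **`T`-complements from generation.** If the classes of the ideals containing `N` generate the
class group, every prime `P` satisfies `(γ) = P · J` for some `γ ≠ 0` and some `J ∋ N ^ k`
(`[J] = [P]⁻¹`). [cite: SilvermanAEC2009, Prop. VIII.1.6 (proof)] -/
theorem exists_span_eq_mul_of_closure_eq_top {N : 𝓞 K}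
    (hgen : Subgroup.closure {c : ClassGroup (𝓞 K) | ∃ (J : Ideal (𝓞 K))
      (hJ : J ∈ (Ideal (𝓞 K))⁰), N ∈ J ∧ ClassGroup.mk0 ⟨J, hJ⟩ = c} = ⊤)
    (P : HeightOneSpectrum (𝓞 K)) :
    ∃ (γ : 𝓞 K) (J : Ideal (𝓞 K)), γ ≠ 0 ∧ span {γ} = P.asIdeal * J ∧ ∃ c : ℕ, N ^ c ∈ J := by
  have hP0 : P.asIdeal ∈ (Ideal (𝓞 K))⁰ := mem_nonZeroDivisors_of_ne_zero P.ne_bot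
  obtain ⟨J, hJ, hJs, hJc⟩ := exists_tsupp_of_mem_closure
    (hgen ▸ Subgroup.mem_top (ClassGroup.mk0 ⟨P.asIdeal, hP0⟩)⁻¹)
  have h1 : ClassGroup.mk0 ⟨P.asIdeal * J, mul_mem hP0 hJ⟩ = 1 := by
    rw [show (⟨P.asIdeal * J, mul_mem hP0 hJ⟩ : (Ideal (𝓞 K))⁰) = ⟨P.asIdeal, hP0⟩ * ⟨J, hJ⟩
      from rfl, map_mul, hJc, mul_inv_cancel]
  have hPJ : (P.asIdeal * J).IsPrincipal := (ClassGroup.mk0_eq_one_iff (mul_mem hP0 hJ)).mp h1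
  refine ⟨hPJ.generator, J, ?_, by rw [Ideal.span_singleton_generator], hJs⟩
  intro h0
  have h := Ideal.span_singleton_generator (P.asIdeal * J)
  rw [h0, span_singleton_eq_bot.mpr rfl] at h
  exact nonZeroDivisors.ne_zero (mul_mem hP0 hJ) h.symm

/-! ## The descent: `K(S,2) ⊆ U_T · Kˣ²` -/

/-- A prime dividing `P` is `P`. [folklore] -/
theorem heightOneSpectrum_eq_of_dvd {v P : HeightOneSpectrum (𝓞 K)} (h : v.asIdeal ∣ P.asIdeal) :
    v = P :=
  HeightOneSpectrum.ext ((P.isPrime.isMaximal P.ne_bot).eq_of_le v.isPrime.ne_top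
    (le_of_dvd h)).symm

/-- **The integral descent.** `N ≠ 0`; every prime `P ∌ N` has a `T`-complement `(γ) = P · J`,
`N ^ c ∈ J`. Then every non-zero `a ∈ 𝓞 K` with `ord_v(a)` even for all primes `v ∌ N` satisfies
`a · z² = t` with `z ∈ Kˣ` and `t ∈ 𝓞 K` all of whose prime divisors contain `N` (induction on
the number of primes `∌ N` dividing `(a)`). [cite: SilvermanAEC2009, Prop. VIII.1.6 (proof)] -/
theorem exists_tsupp_eq_mul_sq_int (N : 𝓞 K) (hN : N ≠ 0)
    (hT : ∀ P : HeightOneSpectrum (𝓞 K), N ∉ P.asIdeal →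
      ∃ (γ : 𝓞 K) (J : Ideal (𝓞 K)), γ ≠ 0 ∧ span {γ} = P.asIdeal * J ∧ ∃ c : ℕ, N ^ c ∈ J) :
    ∀ (a : 𝓞 K), a ≠ 0 →
      (∀ v : HeightOneSpectrum (𝓞 K), N ∉ v.asIdeal →
        (2 : ℤ) ∣ WithZero.log (v.valuation K (a : K))) →
      ∃ (z : K) (t : 𝓞 K), z ≠ 0 ∧
        (∀ v : HeightOneSpectrum (𝓞 K), t ∈ v.asIdeal → N ∈ v.asIdeal) ∧ (a : K) * z ^ 2 = t := by
  suffices key : ∀ (s : ℕ) (a : 𝓞 K) (ha : a ≠ 0), (badSupport N a ha).card = s →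
      (∀ v : HeightOneSpectrum (𝓞 K), N ∉ v.asIdeal →
        (2 : ℤ) ∣ WithZero.log (v.valuation K (a : K))) →
      ∃ (z : K) (t : 𝓞 K), z ≠ 0 ∧
        (∀ v : HeightOneSpectrum (𝓞 K), t ∈ v.asIdeal → N ∈ v.asIdeal) ∧ (a : K) * z ^ 2 = t from
    fun a ha hval => key _ a ha rfl hval
  intro s
  induction s using Nat.strong_induction_on with
  | _ s ih =>
  intro a ha hs hval
  classical
  by_cases hempty : badSupport N a ha = ∅
  · -- every prime dividing `(a)` contains `N`: `a` itself is `T`-supported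
    refine ⟨1, a, one_ne_zero, fun v hv => ?_, by rw [one_pow, mul_one]⟩
    by_contra hNv
    have : v ∈ badSupport N a ha := mem_badSupport.mpr ⟨hv, hNv⟩
    rw [hempty] at this
    exact Finset.notMem_empty v this
  · obtain ⟨P, hP⟩ := Finset.nonempty_of_ne_empty hempty
    obtain ⟨haP, hNP⟩ := mem_badSupport.mp hP
    have hne : ∀ (v : HeightOneSpectrum (𝓞 K)) {r : 𝓞 K}, r ≠ 0 → v.valuation K (r : K) ≠ 0 :=
      fun v r hr => (v.valuation K).ne_zero_iff.mpr (by exact_mod_cast hr)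
    -- `ord_P(a) = 2e > 0`
    have hneg : WithZero.log (P.valuation K (a : K)) < 0 :=
      (log_valuation_neg_iff_mem P ha).mpr haP
    obtain ⟨e', he'⟩ := hval P hNP
    obtain ⟨e, he⟩ : ∃ e : ℕ, WithZero.log (P.valuation K (a : K)) = -(2 * (e : ℤ)) :=
      ⟨(-e').toNat, by rw [he']; omega⟩
    -- the `T`-complement of `P`: `(γ) = P · J`, `N ^ c ∈ J`
    obtain ⟨γ, J, hγ0, hγ, c, hc⟩ := hT P hNP
    have hn0 : N ^ c ≠ 0 := pow_ne_zero c hN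
    have hPJ : ¬ P.asIdeal ∣ J := fun h => hNP (P.isPrime.mem_of_pow_mem c ((le_of_dvd h) hc))
    have hγP : γ ∈ P.asIdeal := by
      have h1 : span {γ} ≤ P.asIdeal := hγ ▸ Ideal.mul_le_right
      exact (span_singleton_le_iff_mem _).mp h1
    have hγP2 : γ ∉ P.asIdeal ^ 2 := by
      intro h2
      have hd : P.asIdeal * P.asIdeal ∣ P.asIdeal * J := by
        rw [← hγ, ← sq]; exact dvd_span_singleton.mpr h2
      exact hPJ ((mul_dvd_mul_iff_left P.ne_bot).mp hd)
    -- valuations of `γ`: `-1` at `P`, `0` at every other prime `∌ N`; of `N ^ c`: `0` off `T`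
    have hlogγP : WithZero.log (P.valuation K (γ : K)) = -1 := by
      have h1 : WithZero.log (P.valuation K (γ : K)) ≤ -((1 : ℕ) : ℤ) :=
        (mem_pow_iff_log_valuation_le P hγ0 1).mp (by rwa [pow_one])
      have h2 : ¬ WithZero.log (P.valuation K (γ : K)) ≤ -((2 : ℕ) : ℤ) := fun h =>
        hγP2 ((mem_pow_iff_log_valuation_le P hγ0 2).mpr h)
      push_cast at h1 h2
      omega
    have hlogγ : ∀ v : HeightOneSpectrum (𝓞 K), v ≠ P → N ∉ v.asIdeal →
        WithZero.log (v.valuation K (γ : K)) = 0 := by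
      intro v hvP hNv
      refine log_valuation_eq_zero_of_not_mem v fun hγv => ?_
      have hd : v.asIdeal ∣ P.asIdeal * J := by rw [← hγ]; exact dvd_span_singleton.mpr hγv
      rcases v.prime.dvd_or_dvd hd with h | h
      · exact hvP (heightOneSpectrum_eq_of_dvd h)
      · exact hNv (v.isPrime.mem_of_pow_mem c ((le_of_dvd h) hc))
    have hlogN : ∀ v : HeightOneSpectrum (𝓞 K), N ∉ v.asIdeal →
        WithZero.log (v.valuation K ((N ^ c : 𝓞 K) : K)) = 0 := fun v hNv =>
      log_valuation_eq_zero_of_not_mem v fun h => hNv (v.isPrime.mem_of_pow_mem c h)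
    -- integrality: `γ^(2e) ∣ a · (N^c)^(2e)`
    have hPa : P.asIdeal ^ (2 * e) ∣ span {a} := by
      rw [dvd_span_singleton, mem_pow_iff_log_valuation_le P ha]
      push_cast
      rw [he]
    have hJd : J ∣ span {N ^ c} := dvd_span_singleton.mpr hc
    have hdvdI : span {γ ^ (2 * e)} ∣ span {a * (N ^ c) ^ (2 * e)} := by
      rw [← Ideal.span_singleton_mul_span_singleton, ← Ideal.span_singleton_pow,
        ← Ideal.span_singleton_pow, hγ, mul_pow]
      exact mul_dvd_mul hPa (pow_dvd_pow_of_dvd hJd _)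
    have hdvd : γ ^ (2 * e) ∣ a * (N ^ c) ^ (2 * e) :=
      Ideal.span_singleton_le_span_singleton.mp (Ideal.le_of_dvd hdvdI)
    obtain ⟨a₁, ha₁⟩ := hdvd
    have ha₁0 : a₁ ≠ 0 := by
      rintro rfl
      rw [mul_zero] at ha₁
      exact mul_ne_zero ha (pow_ne_zero _ hn0) ha₁
    -- name `n₀ = N ^ c` (no cast lemma fires on it)
    generalize hn₀ : N ^ c = n₀ at ha₁ hn0 hlogN
    -- valuations of `a₁`
    have key : (a : K) * (n₀ : K) ^ (2 * e) = (γ : K) ^ (2 * e) * (a₁ : K) := by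
      exact_mod_cast ha₁
    have hloga₁ : ∀ v : HeightOneSpectrum (𝓞 K), WithZero.log (v.valuation K (a₁ : K)) =
        WithZero.log (v.valuation K (a : K)) +
          2 * e * WithZero.log (v.valuation K (n₀ : K)) -
          2 * e * WithZero.log (v.valuation K (γ : K)) := by
      intro v
      have k2 := congrArg (fun x : K => WithZero.log (v.valuation K x)) key
      rw [map_mul, map_pow, map_mul, map_pow,
        WithZero.log_mul (hne v ha) (pow_ne_zero _ (hne v hn0)), WithZero.log_pow,
        WithZero.log_mul (pow_ne_zero _ (hne v hγ0)) (hne v ha₁0), WithZero.log_pow] at k2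
      simp only [nsmul_eq_mul] at k2
      push_cast at k2
      linarith
    have hloga₁' : ∀ v : HeightOneSpectrum (𝓞 K), N ∉ v.asIdeal → v ≠ P →
        WithZero.log (v.valuation K (a₁ : K)) = WithZero.log (v.valuation K (a : K)) := by
      intro v hNv hvP
      rw [hloga₁ v, hlogN v hNv, hlogγ v hvP hNv, mul_zero, add_zero, sub_zero]
    have hloga₁P : WithZero.log (P.valuation K (a₁ : K)) = 0 := by
      rw [hloga₁ P, hlogN P hNP, hlogγP, he]
      ring
    -- the bad support shrinks
    have hsub : badSupport N a₁ ha₁0 ⊆ (badSupport N a ha).erase P := by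
      intro v hv
      obtain ⟨hav, hNv⟩ := mem_badSupport.mp hv
      have hlt := (log_valuation_neg_iff_mem v ha₁0).mpr hav
      have hvP : v ≠ P := by
        rintro rfl
        rw [hloga₁P] at hlt
        exact lt_irrefl _ hlt
      rw [hloga₁' v hNv hvP] at hlt
      exact Finset.mem_erase.mpr ⟨hvP, mem_badSupport.mpr ⟨(log_valuation_neg_iff_mem v ha).mp hlt, hNv⟩⟩
    have hcard : (badSupport N a₁ ha₁0).card < s := by
      calc (badSupport N a₁ ha₁0).card ≤ ((badSupport N a ha).erase P).card :=
            Finset.card_le_card hsub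
        _ < (badSupport N a ha).card := Finset.card_erase_lt_of_mem hP
        _ = s := hs
    -- parity for `a₁`
    have hval₁ : ∀ v : HeightOneSpectrum (𝓞 K), N ∉ v.asIdeal →
        (2 : ℤ) ∣ WithZero.log (v.valuation K (a₁ : K)) := by
      intro v hNv
      by_cases hvP : v = P
      · rw [hvP, hloga₁P]; exact dvd_zero 2
      · rw [hloga₁' v hNv hvP]; exact hval v hNv
    obtain ⟨z₁, t₁, hz₁, ht₁, heq₁⟩ := ih _ hcard a₁ ha₁0 rfl hval₁
    have hγK : (γ : K) ≠ 0 := by exact_mod_cast hγ0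
    have hnK : (n₀ : K) ≠ 0 := by exact_mod_cast hn0
    refine ⟨(n₀ : K) ^ e * z₁ / (γ : K) ^ e, t₁,
      div_ne_zero (mul_ne_zero (pow_ne_zero e hnK) hz₁) (pow_ne_zero e hγK), ht₁, ?_⟩
    rw [← heq₁]
    have hγe : (γ : K) ^ e ≠ 0 := pow_ne_zero e hγK
    rw [div_pow, mul_pow, ← pow_mul, ← pow_mul, mul_comm e 2, mul_div_assoc', div_eq_iff
      (pow_ne_zero _ hγK)]
    linear_combination z₁ ^ 2 * key

/-- **The descent in `Kˣ/Kˣ²`: `K(S,2) ⊆ U_T · Kˣ²`.** `N ≠ 0`; every prime `P ∌ N` has a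
`T`-complement `(γ) = P · J`, `N ^ c ∈ J` (e.g. from
`exists_span_eq_mul_of_closure_eq_top`). If `b ∈ Kˣ` has `ord_v(b)` even for every prime
`v ∌ N`, then `b · z² = t` for some `z ∈ Kˣ` and some non-zero `t ∈ 𝓞 K` all of whose prime
divisors contain `N` (a `T`-unit). [cite: SilvermanAEC2009, Prop. VIII.1.6 (proof)] -/
theorem exists_tsupp_eq_mul_sq (N : 𝓞 K) (hN : N ≠ 0)
    (hT : ∀ P : HeightOneSpectrum (𝓞 K), N ∉ P.asIdeal →
      ∃ (γ : 𝓞 K) (J : Ideal (𝓞 K)), γ ≠ 0 ∧ span {γ} = P.asIdeal * J ∧ ∃ c : ℕ, N ^ c ∈ J)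
    {b : K} (hb : b ≠ 0)
    (hval : ∀ v : HeightOneSpectrum (𝓞 K), N ∉ v.asIdeal →
      (2 : ℤ) ∣ WithZero.log (v.valuation K b)) :
    ∃ (z : K) (t : 𝓞 K), z ≠ 0 ∧ t ≠ 0 ∧
      (∀ v : HeightOneSpectrum (𝓞 K), t ∈ v.asIdeal → N ∈ v.asIdeal) ∧ b * z ^ 2 = t := by
  obtain ⟨x, y, hy, hxy⟩ := IsFractionRing.div_surjective (A := 𝓞 K) b
  have hy0 : y ≠ 0 := nonZeroDivisors.ne_zero hy
  have hy0' : (y : K) ≠ 0 := by exact_mod_cast hy0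
  have hx0 : x ≠ 0 := by
    rintro rfl
    rw [map_zero, zero_div] at hxy
    exact hb hxy.symm
  have ha : ((x * y : 𝓞 K) : K) = b * (y : K) ^ 2 := by
    rw [← hxy]; push_cast; field_simp
  have hval' : ∀ v : HeightOneSpectrum (𝓞 K), N ∉ v.asIdeal →
      (2 : ℤ) ∣ WithZero.log (v.valuation K ((x * y : 𝓞 K) : K)) := by
    intro v hv
    rw [ha]
    refine (two_dvd_log_valuation_mul_iff v hb (pow_ne_zero 2 hy0') ?_).mpr (hval v hv)
    rw [map_pow, WithZero.log_pow]
    exact ⟨_, by rw [two_nsmul, two_mul]⟩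
  obtain ⟨z₁, t₁, hz₁, ht₁, heq⟩ :=
    exists_tsupp_eq_mul_sq_int N hN hT (x * y) (mul_ne_zero hx0 hy0) hval'
  refine ⟨(y : K) * z₁, t₁, mul_ne_zero hy0' hz₁, ?_, ht₁, ?_⟩
  · intro h0
    rw [h0, ha] at heq
    push_cast at heq
    exact (mul_ne_zero (mul_ne_zero hb (pow_ne_zero 2 hy0')) (pow_ne_zero 2 hz₁)) heq
  · rw [ha] at heq
    linear_combination heq

/-- **The descent under class-group generation by the `T`-primes** (the two previous results
combined): if the classes of the ideals containing `N ≠ 0` generate `Cl(𝓞 K)`, every `b ∈ Kˣ`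
with even valuations at all primes `∌ N` is `t / z²` with `t ∈ 𝓞 K ∖ {0}` supported on the primes
containing `N`. [cite: SilvermanAEC2009, Prop. VIII.1.6 (proof)] -/
theorem exists_tsupp_eq_mul_sq_of_closure_eq_top (N : 𝓞 K) (hN : N ≠ 0)
    (hgen : Subgroup.closure {c : ClassGroup (𝓞 K) | ∃ (J : Ideal (𝓞 K))
      (hJ : J ∈ (Ideal (𝓞 K))⁰), N ∈ J ∧ ClassGroup.mk0 ⟨J, hJ⟩ = c} = ⊤) {b : K} (hb : b ≠ 0)
    (hval : ∀ v : HeightOneSpectrum (𝓞 K), N ∉ v.asIdeal →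
      (2 : ℤ) ∣ WithZero.log (v.valuation K b)) :
    ∃ (z : K) (t : 𝓞 K), z ≠ 0 ∧ t ≠ 0 ∧
      (∀ v : HeightOneSpectrum (𝓞 K), t ∈ v.asIdeal → N ∈ v.asIdeal) ∧ b * z ^ 2 = t :=
  exists_tsupp_eq_mul_sq N hN (fun P _ => exists_span_eq_mul_of_closure_eq_top hgen P) hb hval

end Summit.BirchSwinnertonDyer.BirchSwinnertonDyer.Rank2Observatory.TwoDescCl

end
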